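import Literature.NumberTheory.EllipticCurves.XCubeAddDXSharpRankSha
import Literature.NumberTheory.EllipticCurves.XCubeSub82XRankThree
import Literature.NumberTheory.EllipticCurves.SelmerCorankHolds
import Literature.NumberTheory.EllipticCurves.ComplexMultiplicationRationalJIntegralProofs

/-!
# BirchSwinnertonDyer / ShaPrimaryTransfer — crux `FiniteShaComponentTransfer` (stmt-BirchSwinnertonDyer-22356):
# a NON-CM elliptic curve of rank 3 with `Ш[2] = 0` — `W : y² = x³ + x² − 340x` — by complete `2`-isogeny descent

Route `ShaPrimaryTransfer` (D-0145 LINE 2): T = `FiniteShaComponentTransfer` («`t_p(E) = 0 ⟹ t_q(E) = 0`»,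
`t_p(E) = corank_{ℤ_p} Ш(E)[p^∞]`), its door at `2` decided by complete `2`-descent. The companion files certify the
door at `2` in the kernel at ranks `0, 1, 2` (`…OneFiniteShaComponentKernelDoors`) and — on the CM curve
`y² = x³ − 82x` (Silverman, AEC, Remark X.6.1.1) — at rank `3` (`Literature/…/XCubeSub82XShaTwo`). All of
`y² = x³ + Dx` has `j = 1728` (CM). Since the cell's question (F1-sign2) and the printed `2`-converses concern the
NON-CM sector, this helper file (prover seat `bsd-line-spt-p1`, `--supports stmt-22356 --as helper`; route-independent:
no `Theses` import) runs a complete descent via `2`-isogeny on a NON-CM curve of rank `3`: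

  `W : y² = x³ + x² − 340x` (`E_{a,b}` with `a = 1`, `b = −340 = −2²·5·17`; `b' = a² − 4b = 1361`, a prime;
  `W' : y² = x³ − 2x² + 1361x`; `j(W) = 2⁴·1021³/(5²·17²·1361) ∉ ℤ`).

In the tree's currency (Silverman–Tate §3.5–3.6 / AEC X.4.9: `α : W(ℚ) → ℚ*/ℚ*²`, `(x,y) ↦ [x]`, `T ↦ [b]`;
`#α(W(ℚ)) · #ᾱ(W'(ℚ)) = 2^{rank + 2}`, tree `natCard_range_xSqClass_mul`; `rank + 2 ≤ dim₂ S + dim₂ S'`, tree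
`twoIsogeny_mordellWeilRank_add_two_le_holds`; sharp descent ⇒ `Ш[2] = 0`, tree
`forall_mem_sha_two_smul_eq_zero_of_selmerRank_add_le`):

* `natCard_range_xSqClass_340_ge` — `#α(W(ℚ)) ≥ 16`: the points `(−16, 40)`, `(18, 6)`, `(20, 40)`, `(68, 544)` give
  `[−1], [2], [5], [17]`, whence all sixteen classes `{± d : d ∣ 170}`; `natCard_range_xSqClass_1361_ge` —
  `#ᾱ(W'(ℚ)) ≥ 2` (`[1]`, `[1361]`);
* `twoIsogenySelmerRank_add_le_340` — `dim₂ S(1,−340) + dim₂ S(−2,1361) ≤ (ν(340) + 1) + ν(1361) = 5`;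
* **`mordellWeilRank_340_eq_three`** — `rank W(ℚ) = 3` (`2^{rank+2} ≥ 32` and `rank + 2 ≤ 5`);
* **`forall_mem_sha_two_smul_eq_zero_340`** — `Ш(W/ℚ)[2] = 0` (the descent is sharp: `5 = rank + 2`);
  **`door_at_two_rank_three_340`** (`rank = 3 ∧ t_2 = 0`), **`selmerCorank_two_340`** (`corank Sel_{2^∞}(W) = 3`),
  `oneFiniteShaComponent_340` (O for `W`, witness `2`);
* **`not_hasCM_340`** — `W` has no CM (`j(W) ∉ ℤ`; CM `j`-invariants are integral, tree theorem
  `exists_intCast_eq_j_of_hasCM`, Silverman ATAEC II.6.1).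

Everything is UNCONDITIONAL (standard axioms, no named fact). Nothing here proves T, O or BSD; T is conjecture-grade at
rank ≥ 2. The example was found by a seconds-long search for `E_{a,b}` whose two `α`-images fill the a-priori Selmer
bounds (then no local insolubility argument is needed); the companion `…KernelRankThree` reads it through T.
References: J. H. Silverman, *AEC* 2nd ed., X.4.7, X.4.9, Ex. X.4.10; J. H. Silverman, J. Tate, *Rational Points on
Elliptic Curves*, §3.5–3.6; J. H. Silverman, *ATAEC*, Thm. II.6.1; R. Greenberg, LNM 1716 (1999), §1.
-/

-- D-0017: single-problem summit, so `Summit.BirchSwinnertonDyer.BirchSwinnertonDyer.…` repeats a namespace BY DESIGN.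
set_option linter.dupNamespace false

noncomputable section

namespace Summit.BirchSwinnertonDyer.BirchSwinnertonDyer.Theorems.ShaPrimaryTransferNonCMRankThree

open scoped Classical
open Literature.NumberTheory.EllipticCurves Literature.NumberTheory.EllipticCurves.XCubeAddDX
open WeierstrassCurve WeierstrassCurve.Affine

/-! ### Bookkeeping -/

/-- `b(a² − 4b) ≠ 0` for `(a, b) = (1, −340)` (`a² − 4b = 1361`). [folklore] -/
private theorem hab340 : (-340 : ℤ) * ((1 : ℤ) ^ 2 - 4 * (-340)) ≠ 0 := by norm_num

/-- The tree's literal `E_{1,−340}` is `⟨0, 1, 0, −340, 0⟩`. [folklore] -/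
private theorem lit_W : (⟨0, ((1 : ℤ) : ℚ), 0, ((-340 : ℤ) : ℚ), 0⟩ : WeierstrassCurve ℚ) = ⟨0, 1, 0, -340, 0⟩ := by
  ext <;> push_cast <;> ring

/-- The tree's literal `E'_{1,−340} = E_{−2, 1361}` is `⟨0, −2, 0, 1361, 0⟩`. [folklore] -/
private theorem lit_W' :
    (⟨0, ((-2 * 1 : ℤ) : ℚ), 0, (((1 : ℤ) ^ 2 - 4 * (-340) : ℤ) : ℚ), 0⟩ : WeierstrassCurve ℚ) = ⟨0, -2, 0, 1361, 0⟩ := by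
  ext <;> push_cast <;> ring

/-- `W : y² = x³ + x² − 340x` is an elliptic curve (`Δ = 16·340²·1361 ≠ 0`). [folklore] -/
theorem isElliptic_340 : (⟨0, 1, 0, -340, 0⟩ : WeierstrassCurve ℚ).IsElliptic := by
  rw [← lit_W]
  exact isElliptic_mk_of_ne_zero (F := ℚ) hab340

/-- `W' : y² = x³ − 2x² + 1361x`, the `2`-isogenous curve, is an elliptic curve. [folklore] -/
theorem isElliptic_1361 : (⟨0, -2, 0, 1361, 0⟩ : WeierstrassCurve ℚ).IsElliptic := by
  rw [← lit_W']
  exact isElliptic_mk_of_ne_zero (F := ℚ) (twoIsogenyCodomain_ne_zero hab340)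

/-- Squarefree integers with the same class in `ℚ*/ℚ*²` are equal. [folklore] -/
private theorem eq_of_sqClass_intCast_eq {d₁ d₂ : ℤ} (h₁ : Squarefree d₁) (h₂ : Squarefree d₂)
    (he : sqClass (d₁ : ℚ) = sqClass (d₂ : ℚ)) : d₁ = d₂ := by
  have h0₁ : (d₁ : ℚ) ≠ 0 := by exact_mod_cast h₁.ne_zero
  have h0₂ : (d₂ : ℚ) ≠ 0 := by exact_mod_cast h₂.ne_zero
  have h1 : sqClass ((d₁ : ℚ) * d₂) = 1 := by rw [sqClass_mul h0₁ h0₂, he, SqUnits.mul_self]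
  obtain ⟨u, hu⟩ := (sqClass_eq_one_iff (mul_ne_zero h0₁ h0₂)).mp h1
  obtain ⟨m, hm⟩ : IsSquare (d₁ * d₂) := by
    rw [← Rat.isSquare_intCast_iff]
    exact ⟨u, by push_cast; rw [hu, pow_two]⟩
  exact eq_of_squarefree_of_mul_eq_sq h₁ h₂ (m := m) (by rw [hm, pow_two])

/-- Squarefreeness of a small integer from the factorisation of its absolute value. [folklore] -/
private theorem squarefree_int_of_natAbs {d : ℤ} {n : ℕ} (h : d.natAbs = n) (hn : n ≠ 0)
    (hnd : n.primeFactorsList.Nodup) : Squarefree d :=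
  Int.squarefree_natAbs.mp (h ▸ (Nat.squarefree_iff_nodup_primeFactorsList hn).mpr hnd)

/-- A rational solution of `y² = x³ + x² − 340x` with `x ≠ 0` puts `[x]` into `α(W(ℚ))`. [folklore] -/
private theorem sqClass_mem_range_340 {x y : ℚ} (hy : y ^ 2 = x ^ 3 + x ^ 2 - 340 * x) (hx : x ≠ 0) :
    sqClass x ∈ Set.range (⟨0, 1, 0, -340, 0⟩ : WeierstrassCurve ℚ).xSqClass := by
  haveI := isElliptic_340
  have hns : (⟨0, 1, 0, -340, 0⟩ : WeierstrassCurve ℚ).toAffine.Nonsingular x y := by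
    refine Affine.equation_iff_nonsingular.mp ?_
    rw [Affine.equation_iff]
    show y ^ 2 + 0 * x * y + 0 * y = x ^ 3 + 1 * x ^ 2 + (-340) * x + 0
    linear_combination hy
  exact ⟨.some x y hns, xSqClass_some_of_ne_zero _ hx⟩

/-- `[x t²] = [x]` in `ℚ*/ℚ*²`. [folklore] -/
private theorem sqClass_mul_sq' {x t : ℚ} (hx : x ≠ 0) (ht : t ≠ 0) : sqClass (x * t ^ 2) = sqClass x := by
  rw [sqClass_mul hx (pow_ne_zero 2 ht), sqClass_sq, mul_one]

/-! ### `#α(W(ℚ)) ≥ 16` from the points `(−16, 40)`, `(18, 6)`, `(20, 40)`, `(68, 544)` -/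

/-- **`#α(W(ℚ)) ≥ 16` for `W : y² = x³ + x² − 340x`**: the rational points `(−16, 40)`, `(18, 6)`, `(20, 40)`, `(68, 544)`
have `α = [−1], [2], [5], [17]`, and `α(W(ℚ))` is a group, so it contains the sixteen distinct classes
`[±1], [±2], [±5], [±10], [±17], [±34], [±85], [±170]` — ALL of `{± d : d ∣ 340 squarefree}`. [cite: SilvermanTate2015, §3.5–3.6 (α(x,y) = x mod ℚ*²; 2^r = #α(Γ)·#ᾱ(Γ̄)/4)] -/
theorem natCard_range_xSqClass_340_ge :
    (Set.range (⟨0, 1, 0, -340, 0⟩ : WeierstrassCurve ℚ).xSqClass).Finite ∧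
      16 ≤ Nat.card (Set.range (⟨0, 1, 0, -340, 0⟩ : WeierstrassCurve ℚ).xSqClass) := by
  haveI := isElliptic_340
  set W := (⟨0, 1, 0, -340, 0⟩ : WeierstrassCurve ℚ) with hW
  have hfin : (Set.range W.xSqClass).Finite := by
    have h := (natCard_range_xSqClass_le (a := 1) (b := -340) hab340).1
    rw [lit_W] at h
    exact h
  refine ⟨hfin, ?_⟩
  -- generators from the four points
  have g1 : sqClass (-1 : ℚ) ∈ Set.range W.xSqClass := by
    have h := sqClass_mem_range_340 (x := -16) (y := 40) (by norm_num) (by norm_num)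
    rwa [show (-16 : ℚ) = -1 * 4 ^ 2 by norm_num, sqClass_mul_sq' (by norm_num) (by norm_num)] at h
  have g2 : sqClass (2 : ℚ) ∈ Set.range W.xSqClass := by
    have h := sqClass_mem_range_340 (x := 18) (y := 6) (by norm_num) (by norm_num)
    rwa [show (18 : ℚ) = 2 * 3 ^ 2 by norm_num, sqClass_mul_sq' (by norm_num) (by norm_num)] at h
  have g5 : sqClass (5 : ℚ) ∈ Set.range W.xSqClass := by
    have h := sqClass_mem_range_340 (x := 20) (y := 40) (by norm_num) (by norm_num)
    rwa [show (20 : ℚ) = 5 * 2 ^ 2 by norm_num, sqClass_mul_sq' (by norm_num) (by norm_num)] at h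
  have g17 : sqClass (17 : ℚ) ∈ Set.range W.xSqClass := by
    have h := sqClass_mem_range_340 (x := 68) (y := 544) (by norm_num) (by norm_num)
    rwa [show (68 : ℚ) = 17 * 2 ^ 2 by norm_num, sqClass_mul_sq' (by norm_num) (by norm_num)] at h
  have g0 : sqClass (1 : ℚ) ∈ Set.range W.xSqClass := by
    refine ⟨0, ?_⟩
    rw [xSqClass_zero]
    exact ((sqClass_eq_one_iff one_ne_zero).mpr ⟨1, by norm_num⟩).symm
  -- products
  have mul : ∀ {x y : ℚ}, x ≠ 0 → y ≠ 0 → sqClass x ∈ Set.range W.xSqClass → sqClass y ∈ Set.range W.xSqClass →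
      sqClass (x * y) ∈ Set.range W.xSqClass := by
    intro x y hx hy h₁ h₂
    rw [sqClass_mul hx hy]
    exact mul_mem_range_xSqClass W h₁ h₂
  have g10 : sqClass (10 : ℚ) ∈ Set.range W.xSqClass := by
    have h := mul (by norm_num) (by norm_num) g2 g5; norm_num at h; exact h
  have g34 : sqClass (34 : ℚ) ∈ Set.range W.xSqClass := by
    have h := mul (by norm_num) (by norm_num) g2 g17; norm_num at h; exact h
  have g85 : sqClass (85 : ℚ) ∈ Set.range W.xSqClass := by
    have h := mul (by norm_num) (by norm_num) g5 g17; norm_num at h; exact h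
  have g170 : sqClass (170 : ℚ) ∈ Set.range W.xSqClass := by
    have h := mul (by norm_num) (by norm_num) g10 g17; norm_num at h; exact h
  have neg : ∀ {x : ℚ}, x ≠ 0 → sqClass x ∈ Set.range W.xSqClass → sqClass (-x) ∈ Set.range W.xSqClass := by
    intro x hx h
    have h' := mul (by norm_num) hx g1 h
    rwa [neg_one_mul] at h'
  -- the sixteen classes
  set C : Finset ℤ := {1, -1, 2, -2, 5, -5, 10, -10, 17, -17, 34, -34, 85, -85, 170, -170} with hC
  have hsqf : ∀ d ∈ C, Squarefree d := by
    intro d hd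
    simp only [hC, Finset.mem_insert, Finset.mem_singleton] at hd
    rcases hd with rfl | rfl | rfl | rfl | rfl | rfl | rfl | rfl | rfl | rfl | rfl | rfl | rfl | rfl | rfl | rfl
    · exact squarefree_int_of_natAbs (n := 1) rfl one_ne_zero (by simp)
    · exact squarefree_int_of_natAbs (n := 1) rfl one_ne_zero (by simp)
    · exact squarefree_int_of_natAbs (n := 2) rfl two_ne_zero (by simp)
    · exact squarefree_int_of_natAbs (n := 2) rfl two_ne_zero (by simp)
    · exact squarefree_int_of_natAbs (n := 5) rfl (by norm_num) (by simp)
    · exact squarefree_int_of_natAbs (n := 5) rfl (by norm_num) (by simp)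
    · exact squarefree_int_of_natAbs (n := 10) rfl (by norm_num) (by simp)
    · exact squarefree_int_of_natAbs (n := 10) rfl (by norm_num) (by simp)
    · exact squarefree_int_of_natAbs (n := 17) rfl (by norm_num) (by simp)
    · exact squarefree_int_of_natAbs (n := 17) rfl (by norm_num) (by simp)
    · exact squarefree_int_of_natAbs (n := 34) rfl (by norm_num) (by simp)
    · exact squarefree_int_of_natAbs (n := 34) rfl (by norm_num) (by simp)
    · exact squarefree_int_of_natAbs (n := 85) rfl (by norm_num) (by simp)
    · exact squarefree_int_of_natAbs (n := 85) rfl (by norm_num) (by simp)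
    · exact squarefree_int_of_natAbs (n := 170) rfl (by norm_num) (by simp)
    · exact squarefree_int_of_natAbs (n := 170) rfl (by norm_num) (by simp)
  have hsub : (↑(C.image fun d : ℤ => sqClass (d : ℚ)) : Set (SqUnits ℚ)) ⊆ Set.range W.xSqClass := by
    intro c hc
    obtain ⟨d, hd, rfl⟩ := Finset.mem_image.mp (Finset.mem_coe.mp hc)
    simp only [hC, Finset.mem_insert, Finset.mem_singleton] at hd
    rcases hd with rfl | rfl | rfl | rfl | rfl | rfl | rfl | rfl | rfl | rfl | rfl | rfl | rfl | rfl | rfl | rfl <;>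
      push_cast
    · exact g0
    · exact g1
    · exact g2
    · exact neg (by norm_num) g2
    · exact g5
    · exact neg (by norm_num) g5
    · exact g10
    · exact neg (by norm_num) g10
    · exact g17
    · exact neg (by norm_num) g17
    · exact g34
    · exact neg (by norm_num) g34
    · exact g85
    · exact neg (by norm_num) g85
    · exact g170
    · exact neg (by norm_num) g170
  have hcard : (C.image fun d : ℤ => sqClass (d : ℚ)).card = 16 := by
    rw [Finset.card_image_of_injOn (fun d₁ h₁ d₂ h₂ he => eq_of_sqClass_intCast_eq (hsqf d₁ h₁) (hsqf d₂ h₂) he)]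
    rfl
  calc 16 = (↑(C.image fun d : ℤ => sqClass (d : ℚ)) : Set (SqUnits ℚ)).ncard := by rw [Set.ncard_coe_finset, hcard]
    _ ≤ (Set.range W.xSqClass).ncard := Set.ncard_le_ncard hsub hfin
    _ = Nat.card (Set.range W.xSqClass) := (Nat.card_coe_set_eq _).symm

/-! ### `#ᾱ(W'(ℚ)) ≥ 2`: the classes `[1]` and `[1361]` -/

/-- `1361` is prime. [folklore] -/
private theorem prime_1361 : Nat.Prime 1361 := by norm_num

/-- **`#ᾱ(W'(ℚ)) ≥ 2`** for `W' : y² = x³ − 2x² + 1361x`: `ᾱ(O) = [1] ≠ [1361] = ᾱ(T')`. [cite: SilvermanTate2015, §3.5 (α(T) = b mod ℚ*²)] -/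
theorem natCard_range_xSqClass_1361_ge :
    (Set.range (⟨0, -2, 0, 1361, 0⟩ : WeierstrassCurve ℚ).xSqClass).Finite ∧
      2 ≤ Nat.card (Set.range (⟨0, -2, 0, 1361, 0⟩ : WeierstrassCurve ℚ).xSqClass) := by
  haveI := isElliptic_1361
  set W := (⟨0, -2, 0, 1361, 0⟩ : WeierstrassCurve ℚ) with hW
  have hfin : (Set.range W.xSqClass).Finite := by
    have h := (natCard_range_xSqClass_le (a := -2 * 1) (b := (1 : ℤ) ^ 2 - 4 * (-340))
      (twoIsogenyCodomain_ne_zero hab340)).1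
    rw [lit_W'] at h
    exact h
  refine ⟨hfin, ?_⟩
  have g0 : sqClass (((1 : ℤ)) : ℚ) ∈ Set.range W.xSqClass := by
    refine ⟨0, ?_⟩
    rw [xSqClass_zero, Int.cast_one]
    exact ((sqClass_eq_one_iff one_ne_zero).mpr ⟨1, by norm_num⟩).symm
  have gT : sqClass (((1361 : ℤ)) : ℚ) ∈ Set.range W.xSqClass := by
    refine ⟨W.twoTorsionPoint, ?_⟩
    rw [xSqClass_twoTorsionPoint]
    push_cast
    rfl
  have hsqf : ∀ d ∈ ({1, 1361} : Finset ℤ), Squarefree d := by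
    intro d hd
    simp only [Finset.mem_insert, Finset.mem_singleton] at hd
    rcases hd with rfl | rfl
    · exact squarefree_int_of_natAbs (n := 1) rfl one_ne_zero (by simp)
    · exact Int.squarefree_natAbs.mp (by rw [show (1361 : ℤ).natAbs = 1361 from rfl]; exact prime_1361.squarefree)
  have hsub : (↑(({1, 1361} : Finset ℤ).image fun d : ℤ => sqClass (d : ℚ)) : Set (SqUnits ℚ)) ⊆ Set.range W.xSqClass := by
    intro c hc
    obtain ⟨d, hd, rfl⟩ := Finset.mem_image.mp (Finset.mem_coe.mp hc)
    simp only [Finset.mem_insert, Finset.mem_singleton] at hd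
    rcases hd with rfl | rfl
    · exact g0
    · exact gT
  have hcard : (({1, 1361} : Finset ℤ).image fun d : ℤ => sqClass (d : ℚ)).card = 2 := by
    rw [Finset.card_image_of_injOn (fun d₁ h₁ d₂ h₂ he => eq_of_sqClass_intCast_eq (hsqf d₁ h₁) (hsqf d₂ h₂) he)]
    rfl
  calc 2 = (↑(({1, 1361} : Finset ℤ).image fun d : ℤ => sqClass (d : ℚ)) : Set (SqUnits ℚ)).ncard := by
        rw [Set.ncard_coe_finset, hcard]
    _ ≤ (Set.range W.xSqClass).ncard := Set.ncard_le_ncard hsub hfin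
    _ = Nat.card (Set.range W.xSqClass) := (Nat.card_coe_set_eq _).symm

/-! ### The Selmer bound, `rank W(ℚ) = 3`, and `Ш(W/ℚ)[2] = 0` -/

/-- **`dim₂ S(1,−340) + dim₂ S(−2, 1361) ≤ 5`**: `≤ ν(340) + 1 = 4` (signed squarefree divisors of `340 = 2²·5·17`) plus
`≤ ν(1361) = 1` (`1361` prime, `b' > 0`, `a' = −2 ≤ 0`: negative classes die over `ℝ`). [cite: SilvermanAEC2009, Prop. X.4.9 and Example X.4.10] -/
theorem twoIsogenySelmerRank_add_le_340 :
    twoIsogenySelmerRank 1 (-340) + twoIsogenySelmerRank' 1 (-340) ≤ 5 := by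
  have h1 : twoIsogenySelmerRank 1 (-340) ≤ 4 := by
    have h := XCubeAddDX.twoIsogenySelmerRank_le (a := 1) (b := -340) (by norm_num)
    have h340 : (-340 : ℤ).natAbs.primeFactors.card = 3 := by
      rw [show (-340 : ℤ).natAbs = 340 from rfl]
      simp [Nat.primeFactors]
    rwa [h340] at h
  have h2 : twoIsogenySelmerRank' 1 (-340) ≤ 1 := by
    have e : twoIsogenySelmerRank' 1 (-340) = twoIsogenySelmerRank (-2) 1361 := by
      show twoIsogenySelmerRank (-2 * 1) ((1 : ℤ) ^ 2 - 4 * (-340)) = twoIsogenySelmerRank (-2) 1361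
      norm_num
    rw [e]
    have h := twoIsogenySelmerRank_le_of_pos (a := -2) (b := 1361) (by norm_num) (by norm_num)
    have h1361 : (1361 : ℤ).natAbs.primeFactors.card = 1 := by
      rw [show (1361 : ℤ).natAbs = 1361 from rfl, prime_1361.primeFactors, Finset.card_singleton]
    rwa [h1361] at h
  omega

/-- **`rank W(ℚ) = 3` for `W : y² = x³ + x² − 340x`**, UNCONDITIONALLY: `2^{rank + 2} = #α(W(ℚ)) · #ᾱ(W'(ℚ)) ≥ 16 · 2`
(Silverman–Tate, tree `natCard_range_xSqClass_mul`) and `rank + 2 ≤ dim₂ S + dim₂ S' ≤ 5`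
(tree `twoIsogeny_mordellWeilRank_add_two_le_holds`). [cite: SilvermanTate2015, §3.6 (2^r = #α(Γ)·#ᾱ(Γ̄)/4)] -/
theorem mordellWeilRank_340_eq_three : (⟨0, 1, 0, -340, 0⟩ : WeierstrassCurve ℚ).mordellWeilRank = 3 := by
  haveI hE := isElliptic_mk_of_ne_zero (F := ℚ) hab340
  have key := natCard_range_xSqClass_mul (⟨0, ((1 : ℤ) : ℚ), 0, ((-340 : ℤ) : ℚ), 0⟩ : WeierstrassCurve ℚ)
  rw [twoIsogenyCodomain_mk_intCast 1 (-340 : ℤ), lit_W', lit_W] at key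
  obtain ⟨-, h16⟩ := natCard_range_xSqClass_340_ge
  obtain ⟨-, h2⟩ := natCard_range_xSqClass_1361_ge
  have h32 : 2 ^ 5 ≤ 2 ^ ((⟨0, 1, 0, -340, 0⟩ : WeierstrassCurve ℚ).mordellWeilRank + 2) := by
    rw [← key]
    exact le_trans (by norm_num) (Nat.mul_le_mul h16 h2)
  have hge : 5 ≤ (⟨0, 1, 0, -340, 0⟩ : WeierstrassCurve ℚ).mordellWeilRank + 2 :=
    (Nat.pow_le_pow_iff_right Nat.one_lt_two).mp h32
  have hle := twoIsogeny_mordellWeilRank_add_two_le_holds 1 (-340) hab340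
  rw [lit_W] at hle
  have h5 := twoIsogenySelmerRank_add_le_340
  omega

/-- **`Ш(W/ℚ)[2] = 0` for `W : y² = x³ + x² − 340x`**, UNCONDITIONALLY: the descent is sharp
(`dim₂ S + dim₂ S' ≤ 5 = rank + 2`), so `Ш(W)[φ] = Ш(W')[φ̂] = 0` (tree `forall_mem_sha_two_smul_eq_zero_of_selmerRank_add_le`,
Silverman X.4.7) and `φ̂ ∘ φ = [2]`. [cite: SilvermanAEC2009, Prop. X.4.7 and Thm. X.4.2(a)] -/
theorem forall_mem_sha_two_smul_eq_zero_340 :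
    ∀ c ∈ (⟨0, 1, 0, -340, 0⟩ : WeierstrassCurve ℚ).sha, 2 • c = 0 → c = 0 := by
  haveI := isElliptic_halfModel hab340
  haveI := isElliptic_mk_of_ne_zero (F := ℚ) hab340
  have hle : twoIsogenySelmerRank 1 (-340) + twoIsogenySelmerRank' 1 (-340) ≤
      (⟨0, ((1 : ℤ) : ℚ), 0, ((-340 : ℤ) : ℚ), 0⟩ : WeierstrassCurve ℚ).mordellWeilRank + 2 := by
    rw [lit_W, mordellWeilRank_340_eq_three]
    exact twoIsogenySelmerRank_add_le_340
  have h := forall_mem_sha_two_smul_eq_zero_of_selmerRank_add_le hab340 hle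
  have transfer : ∀ {W₁ W₂ : WeierstrassCurve ℚ} (_ : W₁ = W₂),
      (∀ c ∈ W₁.sha, 2 • c = 0 → c = 0) → ∀ c ∈ W₂.sha, 2 • c = 0 → c = 0 := by
    intro W₁ W₂ e h₁
    subst e
    exact h₁
  exact transfer lit_W h

/-- **The NON-CM door at 2 at rank 3: `rank W(ℚ) = 3` and `t_2(W) = 0`** for `W : y² = x³ + x² − 340x`. UNCONDITIONAL.
[cite: SilvermanAEC2009, Prop. X.4.7 and X.4.9] [cite: Greenberg1999LNM, §1] -/
theorem door_at_two_rank_three_340 :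
    (⟨0, 1, 0, -340, 0⟩ : WeierstrassCurve ℚ).mordellWeilRank = 3 ∧ (⟨0, 1, 0, -340, 0⟩ : WeierstrassCurve ℚ).shaCorank 2 = 0 :=
  haveI : Fact (Nat.Prime 2) := ⟨Nat.prime_two⟩
  ⟨mordellWeilRank_340_eq_three,
    (⟨0, 1, 0, -340, 0⟩ : WeierstrassCurve ℚ).shaCorank_eq_zero_of_forall 2 forall_mem_sha_two_smul_eq_zero_340⟩

/-- **`corank_{ℤ_2} Sel_{2^∞}(W/ℚ) = 3 = rank W(ℚ)`** for `W : y² = x³ + x² − 340x`: T's hypothesis in Selmer coordinates,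
kernel-certified on a non-CM curve of rank 3. UNCONDITIONAL. [cite: Greenberg1999LNM, §1 pp. 54–57] -/
theorem selmerCorank_two_340 : (⟨0, 1, 0, -340, 0⟩ : WeierstrassCurve ℚ).selmerCorank 2 = 3 := by
  haveI := isElliptic_340
  haveI : Fact (Nat.Prime 2) := ⟨Nat.prime_two⟩
  rw [(⟨0, 1, 0, -340, 0⟩ : WeierstrassCurve ℚ).selmerCorank_eq_mordellWeilRank_add_holds 2,
    door_at_two_rank_three_340.1, door_at_two_rank_three_340.2]

/-- **O holds for `W : y² = x³ + x² − 340x`** (rank 3, non-CM), witness `p₀ = 2`. UNCONDITIONAL. [cite: Greenberg1999LNM, §1] -/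
theorem oneFiniteShaComponent_340 :
    ∃ (q : ℕ) (_ : Fact q.Prime), (⟨0, 1, 0, -340, 0⟩ : WeierstrassCurve ℚ).shaCorank q = 0 :=
  ⟨2, ⟨Nat.prime_two⟩, door_at_two_rank_three_340.2⟩

/-- **`W : y² = x³ + x² − 340x` has NO complex multiplication**: `j(W) = 2⁴·1021³/(5²·17²·1361)` is not an integer
(`W` has multiplicative reduction at `1361`), while CM `j`-invariants over `ℚ` are integers (tree theorem
`exists_intCast_eq_j_of_hasCM`, Silverman ATAEC II.6.1). [cite: SilvermanATAEC1994, Thm. II.6.1] -/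
theorem not_hasCM_340 : ¬ (⟨0, 1, 0, -340, 0⟩ : WeierstrassCurve ℚ).HasCM := by
  haveI := isElliptic_340
  intro hCM
  obtain ⟨n, hn⟩ := (⟨0, 1, 0, -340, 0⟩ : WeierstrassCurve ℚ).exists_intCast_eq_j_of_hasCM hCM
  have hΔ : (⟨0, 1, 0, -340, 0⟩ : WeierstrassCurve ℚ).Δ = 2517305600 := by
    norm_num [WeierstrassCurve.Δ, WeierstrassCurve.b₂, WeierstrassCurve.b₄, WeierstrassCurve.b₆, WeierstrassCurve.b₈]
  have hc₄ : (⟨0, 1, 0, -340, 0⟩ : WeierstrassCurve ℚ).c₄ = 16336 := by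
    norm_num [WeierstrassCurve.c₄, WeierstrassCurve.b₂, WeierstrassCurve.b₄]
  rw [WeierstrassCurve.j, Units.val_inv_eq_inv_val, WeierstrassCurve.coe_Δ', hΔ, hc₄] at hn
  have h' : (n : ℚ) * 9833225 = 17029316176 := by rw [hn]; norm_num
  have h'' : n * 9833225 = 17029316176 := by exact_mod_cast h'
  omega

end Summit.BirchSwinnertonDyer.BirchSwinnertonDyer.Theorems.ShaPrimaryTransferNonCMRankThree

end
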